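import Summits.CriticalPhenomena.PercolationContinuityZ3.Theorems.FK.OSSSWiredBoxRevealment
import HarnessLib

/-!
# Russo's formula closes the OSSS differential inequality for the wired box measure:
# `n θ_n(1 − θ_n) ≤ 8 p(1−p) S_n θ_n'` (Duminil-Copin–Raoufi–Tassion 2019, §3, (3.2)–(3.4))

Claimed R42 (8)(c) in the cell INBOX at 2026-08-28T02:11:55Z by fkp-10a gen 352 (NEW CLAIM #2 of the gen), addressed to coordinator fk-4 g266 (seated 01:27Z 2026-08-28; R146 l.8252: row FO-10a-g352 = package g352-osss; its (κ) clause sends the FK instantiation to a new claim, R147); lineage row FO-10a-g352f (self-suggested), package g352-fkosss, label FS-F.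
Support file of the `fk-continuity` cell (lineage fkp-10a, `--supports stmt-CriticalPhenomena-4575`); builds on
p205010 (kernel theorem, internal audit signed; external expert review pending).  No definitions, no named facts,
no sorries; standard axioms.  Package `g352-fkosss` = THE FK INSTANTIATION of the OSSS inequality for monotonic measures
(row FO-10a-g352 `g352-osss`): Duminil-Copin–Raoufi–Tassion's Theorem 1.2 (sharpness of the random-cluster phase
transition on `ℤ^d`, `q ≥ 1`) and, on `ℤ²`, `p_c(q) = √q/(1+√q)`.  UNCONDITIONAL; nothing here touches FH / TP_FK / the
`_r3` binders of the cell.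

With `μ_n = φ¹_{Λ_{2n},p,q}`, `θ_n(p) = μ_n(0 ↔ ∂Λ_n)`, `S_n = Σ_{j<n} θ_j`: the derivative formula for random-cluster measures
(Grimmett Thm (2.43)/(3.12), the lineage's `hasDerivAt_rcMeasure_real`: `θ_n' = Cov_{μ_n}(|ω|, 𝟙{0 ↔ ∂Λ_n})/(p(1−p))`),
the decomposition `Cov(|ω|, 𝟙_A) = Σ_{e ∈ E(Λ_{2n})} Cov(ω_e, 𝟙_A)` with every term nonnegative (FKG,
`rcExpect_mul_rcExpect_le_of_monotone`), and the identification of the terms over `E(Λ_n) ⊆ E(Λ_{2n})` with the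
covariances of the summed one-arm OSSS inequality (`OSSSWiredBoxRevealment.lean`) give
`Σ_{e ∈ E(Λ_n)} Cov_{μ_n}(𝟙{0 ↔ ∂Λ_n}, ω_e) ≤ p(1−p) θ_n'(p)` (`sum_cov_le_deriv`) and hence THE DIFFERENTIAL INEQUALITY
`n θ_n(1 − θ_n) ≤ 8 S_n · p(1−p) · θ_n'` for `0 < p < 1`, `q ≥ 1`, `n ≥ 1`, `d ≥ 1` (`wiredBox_oneArm_hasDerivAt_ge`), the
random-cluster version of the tree's Bernoulli `OneArmOSSS.oneArm_hasDerivAt_ge`.  No definitions.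

## References
* H. Duminil-Copin, A. Raoufi, V. Tassion, Ann. of Math. 189 (2019) 75–99, §3 eqs. (3.2)–(3.4). [DuminilCopinRaoufiTassion2019]
* G. Grimmett, *The Random-Cluster Model*, Springer 2006, Thm (2.43)/(3.12) (derivative formula), Thm (3.8) (FKG).
  [Grimmett2006]
-/

noncomputable section

namespace Summit.CriticalPhenomena.PercolationContinuityZ3.Theorems.FK

namespace MonotonicOSSS

open MeasureTheory Finset Function Literature.Probability.ODonnellSaksSchrammServedio2005
open Literature.Probability.Percolation Literature.Probability.LatticeModels
open Literature.Probability.Percolation.GhostExploration Literature.Probability.Percolation.SeedExploration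
open Literature.Probability.Percolation.OneArmOSSS Literature.Probability.Percolation.DCT16
open Classical

variable {d n : ℕ}

/-- On edge sets of a graph, `|ω| = Σ_{e ∈ E} 𝟙{e ∈ ω}`. [folklore] -/
theorem card_eq_sum_ite {α : Type*} [DecidableEq α] {E ω : Finset α} (h : ω ⊆ E) :
    (ω.card : ℝ) = ∑ e ∈ E, (if e ∈ ω then (1 : ℝ) else 0) := by
  rw [Finset.sum_boole]
  congr 1
  rw [Finset.filter_mem_eq_inter, Finset.inter_eq_right.2 h]

/-- A lattice edge `e` of `Λ_n` read through the lift of a box-`Λ_N` configuration: `e ∈ liftEdges ω ↔ e' ∈ ω` for its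
box edge `e'`. [cite: Grimmett2006, §4.2 (E_Λ)] -/
theorem mem_liftEdges_iff_of_map_eq {N : ℕ} {e' : Sym2 ↥(box d N)} {z : Sym2 (Site d)}
    (h : Sym2.map Subtype.val e' = z) (ω : Finset (Sym2 ↥(box d N))) :
    z ∈ liftEdges (box d N) (↑ω : BondConfig ↥(box d N)) ↔ e' ∈ ω := by
  rw [mem_liftEdges_iff]
  constructor
  · rintro ⟨f, hf, hfe⟩
    have : f = e' := Sym2.map.injective Subtype.val_injective (hfe.trans h.symm)
    rw [← this]; exact hf
  · intro he
    exact ⟨e', he, h⟩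

/-- Each edge covariance `Cov_{φ¹_{Λ_N}}(ω_{e'}, 𝟙_A)` of an increasing event is nonnegative (FKG).
[cite: Grimmett2006, Thm (3.8)(b) (positive association)] -/
theorem rcExpect_edge_cov_nonneg {p q : ℝ} (hp : p ∈ Set.Icc (0 : ℝ) 1) (hq : 1 ≤ q) {N : ℕ}
    {A : Set (BondConfig (Site d))} (hA : IsUpperSet A) (e' : Sym2 ↥(box d N)) :
    0 ≤ rcExpect (finsetGraph (zdGraph d) (box d N)) p q (wiredBoundary (zdGraph d) (box d N))
          (fun ω => (if e' ∈ ω then (1 : ℝ) else 0) * (if liftEdges (box d N) (↑ω : BondConfig ↥(box d N)) ∈ A then 1 else 0))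
      - rcExpect (finsetGraph (zdGraph d) (box d N)) p q (wiredBoundary (zdGraph d) (box d N))
          (fun ω => if e' ∈ ω then (1 : ℝ) else 0)
        * rcExpect (finsetGraph (zdGraph d) (box d N)) p q (wiredBoundary (zdGraph d) (box d N))
          (fun ω => if liftEdges (box d N) (↑ω : BondConfig ↥(box d N)) ∈ A then (1 : ℝ) else 0) := by
  refine sub_nonneg.2 (rcExpect_mul_rcExpect_le_of_monotone _ hp hq _ (fun ω => by positivity)
    (fun ω => by positivity) (fun ω ω' hle => ?_) (fun ω ω' hle => ?_))
  · by_cases h : e' ∈ ω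
    · rw [if_pos h, if_pos (hle h)]
    · rw [if_neg h]; split_ifs <;> norm_num
  · by_cases h : liftEdges (box d N) (↑ω : BondConfig ↥(box d N)) ∈ A
    · have h' : liftEdges (box d N) (↑ω' : BondConfig ↥(box d N)) ∈ A :=
        hA (Set.image_mono (Finset.coe_subset.2 hle)) h
      rw [if_pos h, if_pos h']
    · rw [if_neg h]; split_ifs <;> norm_num

/-- **RUSSO + FKG**: `Σ_{e ∈ E(Λ_n)} Cov_{μ_n}(𝟙{0 ↔ ∂Λ_n}, ω_e) ≤ Cov_{μ_n}(|ω|, 𝟙{0 ↔ ∂Λ_n}) = p(1−p) θ_n'(p)` for the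
wired measure `μ_n = φ¹_{Λ_N}`, `n ≤ N`, in the form: the edge-covariance sum is at most
`E[|ω| 𝟙_A] − E|ω| · μ_n(A)`. [cite: DuminilCopinRaoufiTassion2019, §3 eq. (3.3) (θ_n' = Σ_e (J/(e^{βJ}−1)) Cov(𝟙, ω_e) ≥ c Σ_e Cov)] -/
theorem sum_cov_le_cov_card {p q : ℝ} (hp : p ∈ Set.Icc (0 : ℝ) 1) (hq : 1 ≤ q) {N : ℕ} (hnN : n ≤ N) :
    ∑ e : ↥(edgesIn (zdGraph d) (box d n)),
        (regionWiredReal d p q (box d N) (siteToBoundary d n ∩ {ω | e.1 ∈ ω})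
          - regionWiredReal d p q (box d N) (siteToBoundary d n) * regionWiredReal d p q (box d N) {ω | e.1 ∈ ω})
      ≤ rcExpect (finsetGraph (zdGraph d) (box d N)) p q (wiredBoundary (zdGraph d) (box d N))
          (fun ω => (#ω : ℝ) * if (↑ω : BondConfig ↥(box d N)) ∈ liftEdges (box d N) ⁻¹' siteToBoundary d n then 1 else 0)
        - rcExpect (finsetGraph (zdGraph d) (box d N)) p q (wiredBoundary (zdGraph d) (box d N)) (fun ω => (#ω : ℝ))
          * regionWiredReal d p q (box d N) (siteToBoundary d n) := by
  have hq0 : 0 < q := one_pos.trans_le hq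
  set G := finsetGraph (zdGraph d) (box d N)
  set B := wiredBoundary (zdGraph d) (box d N)
  set A : Set (BondConfig (Site d)) := siteToBoundary d n
  -- the edge covariance as a function of a box edge
  set T : Sym2 ↥(box d N) → ℝ := fun e' =>
    rcExpect G p q B (fun ω => (if e' ∈ ω then (1 : ℝ) else 0)
        * (if liftEdges (box d N) (↑ω : BondConfig ↥(box d N)) ∈ A then 1 else 0))
      - rcExpect G p q B (fun ω => if e' ∈ ω then (1 : ℝ) else 0)
        * rcExpect G p q B (fun ω => if liftEdges (box d N) (↑ω : BondConfig ↥(box d N)) ∈ A then (1 : ℝ) else 0) with hT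
  have hT0 : ∀ e', 0 ≤ T e' := fun e' => rcExpect_edge_cov_nonneg hp hq (isUpperSet_siteToBoundary d n) e'
  have hPA : regionWiredReal d p q (box d N) A
      = rcExpect G p q B (fun ω => if liftEdges (box d N) (↑ω : BondConfig ↥(box d N)) ∈ A then (1 : ℝ) else 0) :=
    regionWiredReal_eq_rcExpect d hp hq0 _ _
  -- the lift of the edges of `Λ_n`
  set lift : ↥(edgesIn (zdGraph d) (box d n)) → Sym2 ↥(box d N) := fun e => (exists_boxEdge_map_eq hnN e).choose
    with hlift
  have hliftE : ∀ e, lift e ∈ G.edgeFinset ∧ Sym2.map Subtype.val (lift e) = e.1 := fun e =>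
    (exists_boxEdge_map_eq hnN e).choose_spec
  have hinj : Function.Injective lift := fun e f h =>
    Subtype.ext ((hliftE e).2.symm.trans (by rw [h]; exact (hliftE f).2))
  -- each covariance over `E(Λ_n)` is the box-edge covariance of its lift
  have hCe : ∀ e : ↥(edgesIn (zdGraph d) (box d n)),
      regionWiredReal d p q (box d N) (A ∩ {ω | e.1 ∈ ω})
        - regionWiredReal d p q (box d N) A * regionWiredReal d p q (box d N) {ω | e.1 ∈ ω} = T (lift e) := by
    intro e
    have hmem := fun ω : Finset (Sym2 ↥(box d N)) => mem_liftEdges_iff_of_map_eq (hliftE e).2 ω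
    have h1 : regionWiredReal d p q (box d N) (A ∩ {ω | e.1 ∈ ω})
        = rcExpect G p q B (fun ω => (if lift e ∈ ω then (1 : ℝ) else 0)
          * (if liftEdges (box d N) (↑ω : BondConfig ↥(box d N)) ∈ A then 1 else 0)) := by
      rw [regionWiredReal_eq_rcExpect d hp hq0]
      refine rcExpect_congr _ _ _ _ fun ω _ => ?_
      by_cases h1 : lift e ∈ ω <;>
        by_cases h2 : liftEdges (box d N) (↑ω : BondConfig ↥(box d N)) ∈ A
      · rw [if_pos h1, if_pos h2, if_pos (show _ ∈ A ∩ {ω' : BondConfig (Site d) | e.1 ∈ ω'} from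
          ⟨h2, (hmem ω).2 h1⟩), mul_one]
      · rw [if_pos h1, if_neg h2, if_neg (show ¬ (_ ∈ A ∩ {ω' : BondConfig (Site d) | e.1 ∈ ω'}) from
          fun h => h2 h.1), mul_zero]
      · rw [if_neg h1, if_neg (show ¬ (_ ∈ A ∩ {ω' : BondConfig (Site d) | e.1 ∈ ω'}) from
          fun h => h1 ((hmem ω).1 h.2)), zero_mul]
      · rw [if_neg h1, if_neg (show ¬ (_ ∈ A ∩ {ω' : BondConfig (Site d) | e.1 ∈ ω'}) from
          fun h => h2 h.1), zero_mul]
    have h2 : regionWiredReal d p q (box d N) {ω | e.1 ∈ ω}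
        = rcExpect G p q B (fun ω => if lift e ∈ ω then (1 : ℝ) else 0) := by
      rw [regionWiredReal_eq_rcExpect d hp hq0]
      refine rcExpect_congr _ _ _ _ fun ω _ => ?_
      by_cases h1 : lift e ∈ ω
      · rw [if_pos h1, if_pos (show _ ∈ {ω' : BondConfig (Site d) | e.1 ∈ ω'} from (hmem ω).2 h1)]
      · rw [if_neg h1, if_neg (show ¬ (_ ∈ {ω' : BondConfig (Site d) | e.1 ∈ ω'}) from fun h => h1 ((hmem ω).1 h))]
    rw [h1, h2, hPA, hT, mul_comm]
  -- the covariance with `|ω|` is the sum of the box-edge covariances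
  have hcard : rcExpect G p q B (fun ω => (#ω : ℝ)
        * if (↑ω : BondConfig ↥(box d N)) ∈ liftEdges (box d N) ⁻¹' A then 1 else 0)
      - rcExpect G p q B (fun ω => (#ω : ℝ)) * regionWiredReal d p q (box d N) A = ∑ e' ∈ G.edgeFinset, T e' := by
    rw [hPA, rcExpect_congr G p q B (h := fun ω => ∑ e' ∈ G.edgeFinset, (if e' ∈ ω then (1 : ℝ) else 0)
        * (if liftEdges (box d N) (↑ω : BondConfig ↥(box d N)) ∈ A then 1 else 0)) (fun ω hω => by
          rw [card_eq_sum_ite hω, Finset.sum_mul]; rfl),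
      rcExpect_congr G p q B (g := fun ω => (#ω : ℝ)) (h := fun ω => ∑ e' ∈ G.edgeFinset, (if e' ∈ ω then (1 : ℝ) else 0))
        (fun ω hω => card_eq_sum_ite hω),
      rcExpect_finset_sum, rcExpect_finset_sum, Finset.sum_mul, ← Finset.sum_sub_distrib]
  rw [hcard, Finset.sum_congr rfl fun e _ => hCe e]
  calc ∑ e : ↥(edgesIn (zdGraph d) (box d n)), T (lift e)
      = ∑ e' ∈ Finset.univ.image lift, T e' := (Finset.sum_image fun e _ f _ h => hinj h).symm
    _ ≤ ∑ e' ∈ G.edgeFinset, T e' :=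
        Finset.sum_le_sum_of_subset_of_nonneg (fun e' he' => by
          obtain ⟨e, _, rfl⟩ := Finset.mem_image.1 he'; exact (hliftE e).1) fun e' _ _ => hT0 e'

/-- **THE OSSS DIFFERENTIAL INEQUALITY FOR THE WIRED BOX MEASURE** (`d ≥ 1`, `0 < p < 1`, `q ≥ 1`, `n ≥ 1`): with
`θ_n(r) = φ¹_{Λ_{2n},r,q}(0 ↔ ∂Λ_n)` and `S_n = Σ_{j<n} θ_j(p)`, the function `θ_n` has a derivative `D ≥ 0` at `p` and
`n · θ_n(p)(1 − θ_n(p)) ≤ 8 S_n · p(1−p) · D`. [cite: DuminilCopinRaoufiTassion2019, §3 eqs. (3.2)–(3.4) (θ_n' ≥ c (n/S_n) θ_n)] -/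
theorem wiredBox_oneArm_hasDerivAt_ge (hd : 1 ≤ d) {p q : ℝ} (hp : p ∈ Set.Ioo (0 : ℝ) 1) (hq : 1 ≤ q) {n : ℕ}
    (hn : 1 ≤ n) :
    ∃ D : ℝ, HasDerivAt (fun r => regionWiredReal d r q (box d (2 * n)) (siteToBoundary d n)) D p ∧ 0 ≤ D ∧
      (n : ℝ) * (regionWiredReal d p q (box d (2 * n)) (siteToBoundary d n)
          * (1 - regionWiredReal d p q (box d (2 * n)) (siteToBoundary d n)))
        ≤ 8 * (∑ j ∈ Finset.range n, regionWiredReal d p q (box d (2 * j)) (siteToBoundary d j))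
          * (p * (1 - p)) * D := by
  have hpI : p ∈ Set.Icc (0 : ℝ) 1 := ⟨hp.1.le, hp.2.le⟩
  have hq0 : 0 < q := one_pos.trans_le hq
  have hpp : 0 < p * (1 - p) := mul_pos hp.1 (sub_pos.2 hp.2)
  have hD := hasDerivAt_rcMeasure_real (finsetGraph (zdGraph d) (box d (2 * n))) hq0
    (wiredBoundary (zdGraph d) (box d (2 * n))) (liftEdges (box d (2 * n)) ⁻¹' siteToBoundary d n) hp
  have hcov : (∑ e : ↥(edgesIn (zdGraph d) (box d n)),
      (regionWiredReal d p q (box d (2 * n)) (siteToBoundary d n ∩ {ω | e.1 ∈ ω})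
        - regionWiredReal d p q (box d (2 * n)) (siteToBoundary d n)
          * regionWiredReal d p q (box d (2 * n)) {ω | e.1 ∈ ω}))
      ≤ rcExpect (finsetGraph (zdGraph d) (box d (2 * n))) p q (wiredBoundary (zdGraph d) (box d (2 * n)))
          (fun ω => (#ω : ℝ) * if (↑ω : BondConfig ↥(box d (2 * n)))
            ∈ liftEdges (box d (2 * n)) ⁻¹' siteToBoundary d n then 1 else 0)
        - rcExpect (finsetGraph (zdGraph d) (box d (2 * n))) p q (wiredBoundary (zdGraph d) (box d (2 * n)))
            (fun ω => (#ω : ℝ))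
          * (rcMeasure (finsetGraph (zdGraph d) (box d (2 * n))) p q (wiredBoundary (zdGraph d) (box d (2 * n)))).real
            (liftEdges (box d (2 * n)) ⁻¹' siteToBoundary d n) :=
    sum_cov_le_cov_card (d := d) (n := n) hpI hq (N := 2 * n) (by omega)
  have hC0 : 0 ≤ ∑ e : ↥(edgesIn (zdGraph d) (box d n)),
      (regionWiredReal d p q (box d (2 * n)) (siteToBoundary d n ∩ {ω | e.1 ∈ ω})
        - regionWiredReal d p q (box d (2 * n)) (siteToBoundary d n)
          * regionWiredReal d p q (box d (2 * n)) {ω | e.1 ∈ ω}) :=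
    Finset.sum_nonneg fun e _ => wiredBox_cov_nonneg hp hq (by omega) e
  refine ⟨_, hD, div_nonneg (hC0.trans hcov) hpp.le, ?_⟩
  have hvar := wiredBox_oneArm_variance_sum_le hd hp hq hn
  have hS0 : 0 ≤ 8 * ∑ j ∈ Finset.range n, regionWiredReal d p q (box d (2 * j)) (siteToBoundary d j) :=
    mul_nonneg (by norm_num) (Finset.sum_nonneg fun j _ => measureReal_nonneg)
  refine hvar.trans ?_
  rw [mul_assoc (8 * _), mul_div_cancel₀ _ hpp.ne']
  exact mul_le_mul_of_nonneg_left hcov hS0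

end MonotonicOSSS

end Summit.CriticalPhenomena.PercolationContinuityZ3.Theorems.FK
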